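import Summits.BirchSwinnertonDyer.BirchSwinnertonDyer.Theorems.CycTangentCMCycTangentBoundSplitPrimeSaturation
import Summits.BirchSwinnertonDyer.Rank1Residual.X2.AvatarValueAbovePSplit
import Literature.NumberTheory.EllipticCurves.ComplexMultiplicationDeuringLocalPlaces
import Literature.NumberTheory.EllipticCurves.HeegnerPointsImaginaryQuadraticProofs
import HarnessLib

set_option linter.dupNamespace false
set_option autoImplicit false

/-!
# Crux `CycTangentCM.CycTangentBound` (stmt-BirchSwinnertonDyer-22628), stub `stub_selfDual`, frame
# uniqueness: THE AVATAR OF A TYPE-`(k, 0)` CHARACTER, `k ≠ 0`, IS RAMIFIED AT `v` (nondegeneracy input)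

Seat `bsd-line-ctcm-p2` (line `tangent-cone-parity`, lead `bsd-line-ctcm-p1`). The uniqueness of the
two-variable frame `IsKatzMeasure₂ … ψ⁻¹ … Ω δ Ω_p` (the step `Ǧ = G` behind `stub_selfDual`) is fed by
line supplies (`isKatzMeasure₂_ext_of_lineSupplies`, p587325) whose directions must be pairwise
non-proportional; the non-degeneracy of those directions rests on ONE arithmetic fact, the RAMIFIED
twin of seat p3's (ζ) `isUnramifiedAt_avatar_of_hasInfinityType_zero` (p3, `…SplitPrimeSaturation`):

* §1 `degreeOne_of_ne`, `smul_eq_of_ne_one` — for `K` imaginary quadratic with two distinct places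
  `v ≠ v̄` above `p`: `e(v|p) = f(v|p) = 1`, and the non-trivial automorphism swaps them, `c • v̄ = v`.
* §2 `localEmbedding_eq_embedding`, `embExponent_localEmbedding_eq` — at the place `v` singled out by
  the frames' clause `hι` (`d ∈ v ↔ ‖ι⁻¹(σ_w d)‖ < 1`), the complex embedding `ι ∘ f ∘ ι_v` of a
  continuous local embedding `f : K_v → ℚ̄_p` IS the distinguished `σ_w = w.embedding` (its conjugate
  would induce `c • v = v̄`), so its exponent in the type `(k, q)` is `k`.
* §3 `not_isUnramifiedAt_avatar_of_hasInfinityType_ne_zero` — **the `p`-adic avatar `r` of a Hecke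
  character of type `(k, 0)` with `k ≠ 0`, unramified at `v`, is RAMIFIED at `v`**: by local
  algebraicity (`PNewDisplay.avatar_entry_eq_of_isPAdicAvatarOf`) at a Weil element `w` of inertia
  with Artin image the unit `1 + p ∈ 𝒪_vˣ`, `r(res w) = f(1+p)^{−k} = (1+p)^{−k} ≠ 1` (one local
  embedding, `K_v = ℚ_p`), while `res w` lies in the inertia group of the prime of the completion.

THEOREMS ONLY (no `def`, no fact, no `sorry`); supports, does not close, stmt-BirchSwinnertonDyer-22628.
BSD is not proved by this.

References: [SerreAbelianLadic1968] Ch. III §2.3 (local algebraicity), §A.4; [NeukirchANT1999]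
Ch. I §9 Prop. (9.1), Ch. VI §5; [FrohlichTaylor1990] Ch. III §1 (1.14)(a).
-/

noncomputable section

open scoped NumberField Classical
open NumberField IsDedekindDomain Field
open Literature Literature.NumberTheory.GaloisRepresentations Literature.NumberTheory.EllipticCurves
open Literature.NumberTheory.Automorphic
open Summit.BirchSwinnertonDyer.Rank1Residual Summit.BirchSwinnertonDyer.Rank1Residual.X2
open Summit.BirchSwinnertonDyer.Rank1Residual.X11b

namespace Summit.BirchSwinnertonDyer.BirchSwinnertonDyer.Theorems.CycTangentCMCycTangentBoundAvatarRamified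

variable {p : ℕ} [Fact p.Prime] {K : Type} [Field K] [NumberField K]

/-! ### §1. Two distinct places above `p` in a quadratic field -/

/-- **Distinct places above `p` of a quadratic field have degree one**: if `v ≠ v̄` both contain `p`
then `e(v|p) = 1` and `f(v|p) = 1` (the fundamental identity `Σ e f = 2` in the trichotomy
`placesOver_trichotomy_of_finrank_eq_two`). [cite: FrohlichTaylor1990, Ch. III §1 (1.14)(a)] -/
theorem degreeOne_of_ne (hK2 : Module.finrank ℚ K = 2) {v vbar : HeightOneSpectrum (𝓞 K)}
    (hv : ((p : ℕ) : 𝓞 K) ∈ v.asIdeal) (hvbar : ((p : ℕ) : 𝓞 K) ∈ vbar.asIdeal) (hne : vbar ≠ v) :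
    v.asIdeal.ramificationIdx (𝓞 ℚ) = 1 ∧ v.asIdeal.inertiaDeg (𝓞 ℚ) = 1 := by
  have huv : v.under (𝓞 ℚ) = X11b.ratPlace p := X11b.under_eq_ratPlace_of_mem hv
  have huvbar : vbar.under (𝓞 ℚ) = X11b.ratPlace p := X11b.under_eq_ratPlace_of_mem hvbar
  rcases placesOver_trichotomy_of_finrank_eq_two K hK2 (X11b.ratPlace p) with
    ⟨w₁, w₂, -, -, hef⟩ | ⟨w, hset, -, -⟩ | ⟨w, hset, -, -⟩
  · exact hef v huv
  · have h1 : v ∈ ({w' : HeightOneSpectrum (𝓞 K) | w'.under (𝓞 ℚ) = X11b.ratPlace p}) := huv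
    have h2 : vbar ∈ ({w' : HeightOneSpectrum (𝓞 K) | w'.under (𝓞 ℚ) = X11b.ratPlace p}) := huvbar
    rw [hset, Set.mem_singleton_iff] at h1 h2
    exact absurd (h2.trans h1.symm) hne
  · have h1 : v ∈ ({w' : HeightOneSpectrum (𝓞 K) | w'.under (𝓞 ℚ) = X11b.ratPlace p}) := huv
    have h2 : vbar ∈ ({w' : HeightOneSpectrum (𝓞 K) | w'.under (𝓞 ℚ) = X11b.ratPlace p}) := huvbar
    rw [hset, Set.mem_singleton_iff] at h1 h2
    exact absurd (h2.trans h1.symm) hne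

/-- **The non-trivial automorphism swaps the two places above a split prime**: `c • v̄ = v` for
`v ≠ v̄` above `p` and any `c ≠ 1` (transitivity of `Gal(K/ℚ) = {1, c}` on the places above `p`).
[cite: NeukirchANT1999, Ch. I §9 Prop. (9.1)] -/
theorem smul_eq_of_ne_one (hK2 : Module.finrank ℚ K = 2) {v vbar : HeightOneSpectrum (𝓞 K)}
    (hv : ((p : ℕ) : 𝓞 K) ∈ v.asIdeal) (hvbar : ((p : ℕ) : 𝓞 K) ∈ vbar.asIdeal) (hne : vbar ≠ v)
    {c : K ≃ₐ[ℚ] K} (hc : c ≠ 1) : c • vbar = v := by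
  haveI : Algebra.IsQuadraticExtension ℚ K := ⟨hK2⟩
  have h : vbar.under (𝓞 ℚ) = v.under (𝓞 ℚ) := by
    rw [X11b.under_eq_ratPlace_of_mem hvbar, X11b.under_eq_ratPlace_of_mem hv]
  obtain ⟨σ, hσ⟩ := HeightOneSpectrum.exists_algEquiv_smul_eq (F := ℚ) h
  have hσ1 : σ ≠ 1 := by
    rintro rfl
    rw [one_smul] at hσ
    exact hne hσ
  rwa [Three.LambdaSupply.algEquiv_eq_of_ne_one_of_finrank_eq_two hK2 hc hσ1]

/-! ### §2. The local embedding at the distinguished place is the distinguished embedding -/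

/-- **At the place `v` singled out by `ι`, a continuous local embedding induces the distinguished
complex embedding**: for `K` imaginary quadratic (a CM field), `v ≠ v̄` above `p`, `ι` normalised by
`hι` (`d ∈ v ↔ ‖ι⁻¹(σ_w d)‖ < 1` for every infinite `w`) and `f : K_v →+* ℚ̄_p` continuous, the
embedding `e = ι ∘ f ∘ ι_v` equals `(mk e).embedding`: otherwise it is the conjugate, `e = σ_w ∘ c`,
and `f ∘ ι_v` would induce `c⁻¹ v = v̄` instead of `v` (`‖f(d)‖ < 1 ↔ d ∈ v`).
[cite: NeukirchANT1999, Ch. I §9 Prop. (9.1)] [cite: SerreAbelianLadic1968, Ch. III §2.3] -/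
theorem localEmbedding_eq_embedding [IsCMField K] (ι : PadicAlgCl p ≃+* ℂ)
    (hK2 : Module.finrank ℚ K = 2) {v vbar : HeightOneSpectrum (𝓞 K)}
    (hv : ((p : ℕ) : 𝓞 K) ∈ v.asIdeal) (hvbar : ((p : ℕ) : 𝓞 K) ∈ vbar.asIdeal) (hne : vbar ≠ v)
    (hι : ∀ (w : InfinitePlace K) (d : 𝓞 K), d ∈ v.asIdeal ↔ ‖ι.symm (w.embedding (d : K))‖ < 1)
    (f : v.adicCompletion K →+* PadicAlgCl p) (hf : Continuous f) :
    (ι : PadicAlgCl p →+* ℂ).comp (f.comp (algebraMap K (v.adicCompletion K))) =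
      (InfinitePlace.mk ((ι : PadicAlgCl p →+* ℂ).comp (f.comp (algebraMap K (v.adicCompletion K))))).embedding := by
  set e := (ι : PadicAlgCl p →+* ℂ).comp (f.comp (algebraMap K (v.adicCompletion K))) with he
  by_contra hneq
  -- `e` is the conjugate of the distinguished embedding of its place
  have hconj : ComplexEmbedding.conjugate (InfinitePlace.mk e).embedding = e := by
    have h := (InfinitePlace.mk_eq_iff (φ := (InfinitePlace.mk e).embedding) (ψ := e)).mp
      (InfinitePlace.mk_embedding _)
    exact h.resolve_left (Ne.symm hneq)
  -- the complex conjugation of `K` as a `ℚ`-automorphism swaps `v̄ ↦ v`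
  set c : K ≃ₐ[ℚ] K := (IsCMField.complexConj K).restrictScalars ℚ with hc
  have hc1 : c ≠ 1 := Three.LambdaSupply.restrictScalars_complexConj_ne_one
  have hcv : c • vbar = v := smul_eq_of_ne_one hK2 hv hvbar hne hc1
  -- `d ∈ v̄ ↔ c • d ∈ v ↔ ‖ι⁻¹ σ_w (c d)‖ < 1 ↔ ‖f(d)‖ < 1 ↔ d ∈ v`
  have key : ∀ d : 𝓞 K, d ∈ vbar.asIdeal ↔ d ∈ v.asIdeal := by
    intro d
    rw [← HeightOneSpectrum.smul_mem_smul_asIdeal_iff c vbar d, hcv,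
      hι (InfinitePlace.mk e) (c • d), ← PadicEmbedding.norm_map_algebraMap_lt_one_iff f hf d]
    have h1 : (InfinitePlace.mk e).embedding ((c • d : 𝓞 K) : K) = e ((d : 𝓞 K) : K) := by
      rw [RingOfIntegers.coe_algEquiv_smul, hc, AlgEquiv.restrictScalars_apply,
        IsCMField.complexEmbedding_complexConj]
      conv_rhs => rw [← hconj]
      rw [ComplexEmbedding.conjugate_coe_eq]
    rw [h1, he]
    simp only [RingHom.coe_comp, RingHom.coe_coe, Function.comp_apply, RingEquiv.symm_apply_apply]
  exact hne (HeightOneSpectrum.ext (le_antisymm (fun d hd ↦ (key d).mp hd) (fun d hd ↦ (key d).mpr hd)))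

/-- **The exponent of the local embedding at `v` in the type `(k, q)` is `k`** (it is the
distinguished embedding of its — complex — place). [cite: SerreAbelianLadic1968, Ch. III §2.3] -/
theorem embExponent_localEmbedding_eq [IsCMField K] (ι : PadicAlgCl p ≃+* ℂ)
    (hK : IsImaginaryQuadratic K) {v vbar : HeightOneSpectrum (𝓞 K)}
    (hv : ((p : ℕ) : 𝓞 K) ∈ v.asIdeal) (hvbar : ((p : ℕ) : 𝓞 K) ∈ vbar.asIdeal) (hne : vbar ≠ v)
    (hι : ∀ (w : InfinitePlace K) (d : 𝓞 K), d ∈ v.asIdeal ↔ ‖ι.symm (w.embedding (d : K))‖ < 1)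
    (f : v.adicCompletion K →+* PadicAlgCl p) (hf : Continuous f) (k q : ℤ) :
    HeckeCharacter.embExponent (fun _ : InfinitePlace K ↦ k) (fun _ ↦ q)
      ((ι : PadicAlgCl p →+* ℂ).comp (f.comp (algebraMap K (v.adicCompletion K)))) = k := by
  set e := (ι : PadicAlgCl p →+* ℂ).comp (f.comp (algebraMap K (v.adicCompletion K))) with he
  have hnr : ¬ ComplexEmbedding.IsReal e := fun h ↦
    (InfinitePlace.not_isReal_iff_isComplex.mpr (hK.2.isComplex (InfinitePlace.mk e)))
      (InfinitePlace.isReal_mk_iff.mpr h)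
  have heq : e = (InfinitePlace.mk e).embedding := localEmbedding_eq_embedding ι hK.1 hv hvbar hne hι f hf
  unfold HeckeCharacter.embExponent
  rw [if_neg hnr, if_pos heq]

/-! ### §3. The avatar of a type-`(k, 0)` character, `k ≠ 0`, is ramified at `v` -/

/-- `(1 + p)^{k} = 1` in `ℚ̄_p` forces `k = 0`. [folklore] -/
theorem zpow_one_add_prime_eq_one_iff (k : ℤ) : ((1 : PadicAlgCl p) + p) ^ k = 1 ↔ k = 0 := by
  refine ⟨fun h ↦ ?_, fun h ↦ by rw [h, zpow_zero]⟩
  have h1 : ((1 + p : ℚ) : PadicAlgCl p) ^ k = ((1 : ℚ) : PadicAlgCl p) := by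
    push_cast; exact h
  rw [← Rat.cast_zpow, Rat.cast_inj] at h1
  have hpos : (0 : ℚ) < 1 + p := by positivity
  have hne1 : (1 + p : ℚ) ≠ 1 := by
    have : (0 : ℚ) < p := by exact_mod_cast (Fact.out : p.Prime).pos
    linarith
  exact zpow_right_injective₀ hpos hne1 (show (1 + (p : ℚ)) ^ k = (1 + (p : ℚ)) ^ (0 : ℤ) by rw [h1, zpow_zero])

/-- **The `p`-adic avatar of a Hecke character of infinity type `(k, 0)`, `k ≠ 0`, unramified at `v`,
is RAMIFIED at `v`** (`K` imaginary quadratic, `v ≠ v̄` above `p`, `ι` normalised by the frames'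
clause `hι`). At a Weil element `w` of the local inertia with Artin image the unit `1 + p ∈ 𝒪_vˣ`,
local algebraicity (`PNewDisplay.avatar_entry_eq_of_isPAdicAvatarOf`) reads
`r(res w) = φ(⟨1+p⟩_v) · f(1+p)^{−n_f} = (1+p)^{−k}` (`φ` unramified at `v` kills the local unit; at a
degree-one place there is ONE continuous local embedding `f`, of exponent `k`, §2); `(1+p)^{−k} ≠ 1`,
while `res w` lies in the inertia group of the prime of the completion above `v`.
[cite: SerreAbelianLadic1968, Ch. III §2.3] [cite: NeukirchANT1999, Ch. VI §5 Prop. (5.6)] -/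
theorem not_isUnramifiedAt_avatar_of_hasInfinityType_ne_zero (ι : PadicAlgCl p ≃+* ℂ)
    (hK : IsImaginaryQuadratic K) {v vbar : HeightOneSpectrum (𝓞 K)}
    (hv : ((p : ℕ) : 𝓞 K) ∈ v.asIdeal) (hvbar : ((p : ℕ) : 𝓞 K) ∈ vbar.asIdeal) (hne : vbar ≠ v)
    (hι : ∀ (w : InfinitePlace K) (d : 𝓞 K), d ∈ v.asIdeal ↔ ‖ι.symm (w.embedding (d : K))‖ < 1)
    {φ : HeckeCharacter K} {k : ℤ} (hk : k ≠ 0) (hinf : φ.HasInfinityType (fun _ ↦ k) (fun _ ↦ 0))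
    {T : Finset (HeightOneSpectrum (𝓞 K))} (hT : ∀ w, w ∉ T → φ.IsUnramifiedAt w)
    (hunr : φ.IsUnramifiedAt v)
    {r : FramedGaloisRep K (PadicAlgCl p) 1} (hav : IsPAdicAvatarOf ι φ r) :
    ¬ r.IsUnramifiedAt v := by
  haveI : IsCMField K := hK.isCMField
  have hp : p.Prime := Fact.out
  intro hr
  obtain ⟨he, hf⟩ := degreeOne_of_ne hK.1 hv hvbar hne
  -- the Artin map and a Weil element of inertia over the unit `1 + p`
  obtain ⟨a, ha⟩ := exists_isLocalArtinMap_holds (v.adicCompletion K)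
  have hpv : Valued.v (algebraMap K (v.adicCompletion K) (p : K)) < 1 := by
    have h := (IsDedekindDomain.HeightOneSpectrum.valuation_lt_one_iff_mem (K := K) v ((p : ℕ) : 𝓞 K)).mpr hv
    rw [Literature.NumberTheory.GaloisRepresentations.valued_algebraMap_adicCompletion]
    exact_mod_cast h
  have hval1 : Valued.v ((1 : v.adicCompletion K) + algebraMap K (v.adicCompletion K) (p : K)) = 1 :=
    Valuation.map_one_add_of_lt _ hpv
  have hz0 : (1 : v.adicCompletion K) + algebraMap K (v.adicCompletion K) (p : K) ≠ 0 := by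
    intro h0; rw [h0, map_zero] at hval1; exact zero_ne_one hval1
  set z : (v.adicCompletion K)ˣ := Units.mk0 _ hz0 with hz
  have hzval : Valued.v ((z : (v.adicCompletion K)ˣ) : v.adicCompletion K) = 1 := by
    rw [hz, Units.val_mk0]; exact hval1
  have hzU : z ∈ (ValuativeRel.valuation (v.adicCompletion K)).valuationSubring.unitGroup := by
    rw [Valuation.mem_unitGroup_iff]
    exact (ValuativeRel.isEquiv (Valued.v : Valuation (v.adicCompletion K) (WithZero (Multiplicative ℤ)))
      (ValuativeRel.valuation (v.adicCompletion K))).eq_one_iff_eq_one.mp hzval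
  rw [← ha.image_inertia] at hzU
  obtain ⟨w, hwI, hw⟩ := Subgroup.mem_map.mp hzU
  -- local algebraicity at `w`
  obtain ⟨f₀, hf₀⟩ := PNewDisplay.exists_continuous_localEmbedding_of_degreeOne hv he hf
  have key := PNewDisplay.avatar_entry_eq_of_isPAdicAvatarOf hinf ι hT hav hv a ha w
  rw [hw, PNewDisplay.univ_localEmbedding_eq_singleton hv he hf ⟨f₀, hf₀⟩, Finset.prod_singleton,
    hunr.map_localUnits_eq_one z hzval, Units.val_one, map_one, one_mul] at key
  have hexp : HeckeCharacter.embExponent (fun _ : InfinitePlace K ↦ k) (fun _ ↦ (0 : ℤ))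
      ((ι : PadicAlgCl p →+* ℂ).comp
        ((⟨f₀, hf₀⟩ : {e : v.adicCompletion K →+* PadicAlgCl p // Continuous e}).1.comp
          (algebraMap K (v.adicCompletion K)))) = k :=
    embExponent_localEmbedding_eq ι hK hv hvbar hne hι f₀ hf₀ k 0
  have hfz : f₀ ((z : (v.adicCompletion K)ˣ) : v.adicCompletion K) = 1 + (p : PadicAlgCl p) := by
    rw [hz, Units.val_mk0, map_add, map_one, map_natCast, map_natCast]
  rw [hexp] at key
  change ((r _ : GL (Fin 1) (PadicAlgCl p)) : Matrix (Fin 1) (Fin 1) (PadicAlgCl p)) 0 0 =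
    f₀ ((z : (v.adicCompletion K)ˣ) : v.adicCompletion K) ^ (-k) at key
  rw [hfz] at key
  -- `res w` is an inertia element above `v`, so `r(res w) = 1`
  have hmem : absGaloisRestrict K (v.adicCompletion K) (WeilGroup.toAbsGalois (v.adicCompletion K) w) ∈
      (adicCompletionPrime K v).inertia (absoluteGaloisGroup K) := by
    rw [inertia_adicCompletionPrime_eq_map_absInertia]
    exact Subgroup.mem_map_of_mem _ (WeilGroup.mem_inertia_iff.mp hwI)
  have h1 := hr _ (adicCompletionPrime_mem_primesAbove K v) _ hmem
  rw [h1, Units.val_one, Matrix.one_apply_eq] at key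
  have h2 : ((1 : PadicAlgCl p) + p) ^ (-k) = 1 := key.symm
  exact hk (neg_eq_zero.mp ((zpow_one_add_prime_eq_one_iff (-k)).mp h2))

end Summit.BirchSwinnertonDyer.BirchSwinnertonDyer.Theorems.CycTangentCMCycTangentBoundAvatarRamified

end
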